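import Summits.CriticalPhenomena.PercolationContinuityZ3.Theorems.PercNearOneGluingNoHeavyQuantFlowSplit
import Summits.CriticalPhenomena.PercolationContinuityZ3.Theorems.PercNearOneGluingNoHeavyQuantLightTwoBlobDEC
import HarnessLib

/-!
# QUANT lane R8, T-DEC: Theorem E, part 2 — a sub-flow's law as the mixture of its corner pairs; corner pairs without light straddlers
# (LEAD-NOTES-G23 N52)

builds on p205010 (kernel theorem, internal audit signed; external expert review pending)

Support file (`--supports stmt-CriticalPhenomena-4575`), QUANT lane lead seat prim-quant-lead (gen 23), rung R8 of
`run/shared/lean/prim/quant/LADDER.md`.  Theorems only; standard axioms, no sorries.  See `…QuantSliceLamColumnsBudget` (part 1) for the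
statement of THEOREM E and `…QuantSliceLamColumns` for its proof.
* `bvalidAt_cornerPair` — a corner pair `{l, h; pairGate x T l h}` that is heavy (`x ≤ pairGate`) or has `h + a ≤ j′` is `BValidAt`
  (the validity half of `bdecAtT_subflowLaw`, `…QuantFlowSplit`, isolated);
* `bdecAtT_single` — a single `BValidAt` two-point law is `BDECAtT`;  `slice_fintype_sum` — slicing commutes with finite mixtures;
* **`subflowLaw_eq_mixture`** — the normalised law of a sub-flow of a flow witness (all charged columns mids `≤ j′`) is the mixture of the
  two-point laws `{l, h; pairGate x T l h}` with weights `f_B(l,h)/((1 − pairGate)·c)` (the law identity of `bdecAtT_subflowLaw` without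
  its side condition, so that the pairs can be sliced ONE BY ONE — below/heavy pairs by the typer's `slice_decAtT_of_bdecAtT'`, cheap band
  pairs by the BAND PIECE).

[this work]; nothing here is cited as a published result.  The gluing rows served [cite: KozmaNitzan2024, Conjecture 3 (p. 15)]; product
measure [cite: Grimmett1999, §1.3 p. 10].
-/

noncomputable section

namespace Summit.CriticalPhenomena.PercolationContinuityZ3.Theorems

namespace Quant

open Finset

/-- the two-point law `{lo, hi; g}` (as in `…QuantLawDEC`) -/
local notation3 "TP[" lo ", " hi ", " g ", " h "]" =>
  (g : ℝ) * (if (h : ℕ) = (hi : ℕ) then (1 : ℝ) else 0) + (1 - (g : ℝ)) * (if (h : ℕ) = (lo : ℕ) then (1 : ℝ) else 0)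

namespace LawDec

/-! ### Theorem E, part 2: corner pairs one by one -/

section LamColumnsPairs

variable (x T g : ℝ) (j' M a lam : ℕ) (ν : ℕ → ℝ)

/-- a corner pair `{l, h; pairGate x T l h}` (`2l < T < l + h`, `l < h ≤ j′`) that is HEAVY (`x ≤ pairGate`) or stays below the layer after the
shift (`h + a ≤ j′`) is valid without a light straddler. [this work] -/
theorem bvalidAt_cornerPair (l h : ℕ) (hx0 : 0 < x) (hx1 : x < 1) (hlow : 2 * (l : ℝ) < T)
    (hlh : l < h) (hhj : h ≤ j') (hB : h + a ≤ j' ∨ x ≤ pairGate x T l h) :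
    BValidAt x T j' a l h (pairGate x T l h) := by
  have hml : (0:ℝ) < (h:ℝ) - l := by
    have : (l:ℝ) < h := by exact_mod_cast hlh
    linarith
  set ρ := (T - 2 * (l : ℝ)) / ((h : ℝ) - l) with hρ
  have hγ : pairGate x T l h = max ρ (x ^ 2 + (1 - x) * ρ) := rfl
  by_cases hheavy : x ≤ pairGate x T l h
  · refine Or.inl (Or.inr (Or.inr ⟨hlh, hhj, hheavy, ?_⟩))
    have hρle : ρ ≤ pairGate x T l h := by rw [hγ]; exact le_max_left _ _
    have : T - 2 * (l:ℝ) ≤ ((h:ℝ) - l) * pairGate x T l h := by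
      have := mul_le_mul_of_nonneg_left hρle hml.le
      rwa [hρ, mul_div_cancel₀ _ hml.ne'] at this
    linarith
  · have hlt : pairGate x T l h < x := not_le.1 hheavy
    have hBa : h + a ≤ j' := by
      rcases hB with hB | hB
      · exact hB
      · exact absurd hB hheavy
    refine Or.inr (Or.inr ⟨hlh, hBa, ?_, hlt, ?_⟩)
    · have hρ0 : 0 < ρ := div_pos (by linarith) hml
      have : x ^ 2 + (1 - x) * ρ ≤ pairGate x T l h := by rw [hγ]; exact le_max_right _ _
      nlinarith
    · have hρx : ρ < x := lt_of_le_of_lt (by rw [hγ]; exact le_max_left _ _) hlt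
      have hγeq : pairGate x T l h = x ^ 2 + (1 - x) * ρ := by
        rw [hγ]; refine max_eq_right ?_; nlinarith
      rw [hγeq]
      have h1x : (1:ℝ) - x ≠ 0 := ne_of_gt (by linarith)
      have e : (x ^ 2 + (1 - x) * ρ - x ^ 2) / (1 - x) = ρ := by field_simp; ring
      rw [e, hρ, mul_div_cancel₀ _ hml.ne']
      linarith

/-- a single two-point law valid without a light straddler is `BDECAtT`. [this work] -/
theorem bdecAtT_single (lo hi : ℕ) (γ : ℝ) (hγ : 0 ≤ γ ∧ γ ≤ 1) (hlohi : lo ≤ hi) (hhi : hi ≤ M)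
    (hval : BValidAt x T j' a lo hi γ) : BDECAtT x T j' M a (fun k => TP[lo, hi, γ, k]) :=
  ⟨Unit, inferInstance, fun _ => 1, fun _ => γ, fun _ => lo, fun _ => hi, fun _ => zero_le_one, by simp, fun _ => hγ,
    fun _ => hlohi, fun _ => hhi, fun h => by simp, fun _ _ => hval⟩

/-- slicing commutes with finite mixtures. [this work] -/
theorem slice_fintype_sum {ι : Type} [Fintype ι] (w : ι → ℝ) (P : ι → ℕ → ℝ) (aa : ℕ) (gg : ℝ) (h : ℕ) :
    slice (fun k => ∑ i, w i * P i k) aa gg h = ∑ i, w i * slice (P i) aa gg h := by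
  unfold slice
  by_cases ha : aa ≤ h
  · simp only [if_pos ha]
    rw [Finset.mul_sum, Finset.mul_sum, ← Finset.sum_add_distrib]
    exact Finset.sum_congr rfl fun i _ => by ring
  · simp only [if_neg ha, mul_zero, add_zero]
    rw [Finset.mul_sum]
    exact Finset.sum_congr rfl fun i _ => by ring

/-- **a sub-flow's law is the mixture of its corner pairs** `{l, h; pairGate x T l h}` with weights `f_B(l,h)/((1 − pairGate)·c)`
(all charged columns mids `h ≤ j′`; `c` the sub-law's mass, `subflowLaw_mass`). [this work] -/
theorem subflowLaw_eq_mixture (f fB : ℕ → ℕ → ℝ) (hx0 : 0 < x) (hx1 : x < 1) (hνM : ∀ k, M < k → ν k = 0)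
    (hf : IsFlowAtT x T j' M ν f) (h0 : ∀ l h, 0 ≤ fB l h) (hle : ∀ l h, fB l h ≤ f l h)
    (hmid : ∀ l h, 0 < fB l h → h ≤ j') (c : ℝ) (hcpos : 0 < c) (k : ℕ) :
    subflowLaw x T j' M fB k / c = ∑ r : Fin (j' + 1) × Fin (M + 1),
      fB r.1 r.2 / ((1 - pairGate x T r.1 r.2) * c) * TP[(r.1 : ℕ), (r.2 : ℕ), pairGate x T r.1 r.2, k] := by
  classical
  have ch : ∀ l h, 0 < fB l h → h ≤ M ∧ pairGate x T l h < 1 ∧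
      usage x T j' l h = pairGate x T l h / (1 - pairGate x T l h) := by
    intro l h hp
    obtain ⟨-, hlow, hhM, hcmp, -, -⟩ := subflow_pair x T j' M ν f fB hx0 hx1 hf hle l h hp
    have hhj : h ≤ j' := hmid l h hp
    have hcomp : T < (l : ℝ) + h := by
      rcases hcmp with hcmp | hcmp
      · omega
      · exact hcmp
    refine ⟨hhM, pairGate_lt_one x T l h hx0 hx1 hlow hcomp, ?_⟩
    unfold usage gateOf; rw [if_neg (by omega)]
  have conv : ∑ r : Fin (j' + 1) × Fin (M + 1), fB r.1 r.2 / ((1 - pairGate x T r.1 r.2) * c) *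
      TP[(r.1 : ℕ), (r.2 : ℕ), pairGate x T r.1 r.2, k]
      = ∑ l ∈ Finset.range (j' + 1), ∑ h ∈ Finset.range (M + 1), fB l h / ((1 - pairGate x T l h) * c) *
        TP[l, h, pairGate x T l h, k] := by
    rw [Fintype.sum_prod_type, ← Fin.sum_univ_eq_sum_range
      (fun l => ∑ h ∈ Finset.range (M + 1), fB l h / ((1 - pairGate x T l h) * c) * TP[l, h, pairGate x T l h, k]) (j' + 1)]
    refine Fintype.sum_congr _ _ fun i => ?_
    exact Fin.sum_univ_eq_sum_range (fun h => fB i h / ((1 - pairGate x T i h) * c) * TP[(i : ℕ), h, pairGate x T i h, k]) (M + 1)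
  rw [conv]
  have et : ∀ l h, fB l h / ((1 - pairGate x T l h) * c) * TP[l, h, pairGate x T l h, k]
      = (usage x T j' l h * fB l h * (if k = h then (1:ℝ) else 0) + fB l h * (if k = l then (1:ℝ) else 0)) / c := by
    intro l h
    rcases (h0 l h).eq_or_lt with hz | hp
    · rw [← hz]; simp
    · obtain ⟨-, hγ1, hu⟩ := ch l h hp
      have hne : (1:ℝ) - pairGate x T l h ≠ 0 := ne_of_gt (by linarith)
      have hcne : c ≠ 0 := hcpos.ne'
      rw [hu, div_mul_eq_mul_div, div_eq_div_iff (mul_ne_zero hne hcne) hcne]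
      field_simp
  simp only [et, ← Finset.sum_div]
  congr 1
  have hcolz : ∀ l, M < k → fB l k = 0 := by
    intro l hk
    rcases (h0 l k).eq_or_lt with hz | hp'
    · exact hz.symm
    · exact absurd (ch l k hp').1 (by omega)
  have eA : ∑ l ∈ Finset.range (j' + 1), ∑ h ∈ Finset.range (M + 1),
      usage x T j' l h * fB l h * (if k = h then (1:ℝ) else 0) = ∑ l ∈ Finset.range (j' + 1), usage x T j' l k * fB l k := by
    refine Finset.sum_congr rfl fun l _ => ?_
    rw [show (∑ h ∈ Finset.range (M + 1), usage x T j' l h * fB l h * (if k = h then (1:ℝ) else 0))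
        = ∑ h ∈ Finset.range (M + 1), (if k = h then usage x T j' l h * fB l h else 0) from
          Finset.sum_congr rfl fun h _ => by split_ifs <;> ring,
      Finset.sum_ite_eq]
    split_ifs with hk
    · rfl
    · rw [Finset.mem_range] at hk
      rw [hcolz l (by omega), mul_zero]
  have eB : ∑ l ∈ Finset.range (j' + 1), ∑ h ∈ Finset.range (M + 1), fB l h * (if k = l then (1:ℝ) else 0)
      = ∑ h ∈ Finset.range (M + 1), fB k h := by
    rw [Finset.sum_comm]
    refine Finset.sum_congr rfl fun h _ => ?_
    rw [show (∑ l ∈ Finset.range (j' + 1), fB l h * (if k = l then (1:ℝ) else 0))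
        = ∑ l ∈ Finset.range (j' + 1), (if k = l then fB l h else 0) from
          Finset.sum_congr rfl fun l _ => by split_ifs <;> ring,
      Finset.sum_ite_eq]
    split_ifs with hk
    · rfl
    · rw [Finset.mem_range] at hk
      exact (subflow_row_eq_zero x T j' M ν f fB hx0 hx1 hνM hf h0 hle k (Or.inl (by omega)) h).symm
  unfold subflowLaw
  rw [Finset.sum_congr rfl (fun l _ => Finset.sum_add_distrib), Finset.sum_add_distrib, eA, eB, add_comm]

end LamColumnsPairs

end LawDec

end Quant

end Summit.CriticalPhenomena.PercolationContinuityZ3.Theorems
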